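import Literature.NumberTheory.Automorphic.ArchGardingSegal
import Literature.NumberTheory.Automorphic.ArchPlaceCasimirComplex
import HarnessLib

/-!
# The place Casimir operators act by scalars on the Gårding space of an irreducible unitary representation

Topic `NumberTheory/Automorphic`; namespace `Literature.NumberTheory.Automorphic`. Theorems only (no
definition, no named fact). For an irreducible unitary strongly continuous representation `τ` of
`G_∞ = GL_n(K_∞)` on a Hilbert space, with Gårding space `𝒢`:

* `exists_placeCasimirReal_eq_smul` — for a real place `w`, the Casimir operator
  `C_w = Σ_{ij} τ(E_{ij} ⊗ r_w) τ(E_{ji} ⊗ r_w)` of the factor `𝔤𝔩_n(ℝ)` is a scalar on `𝒢`;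
* `exists_placeCasimirHol_eq_smul`, `exists_placeCasimirAnti_eq_smul` — for a complex place `w`, the
  holomorphic and antiholomorphic Casimir operators `Σ_{ij} τ^{hol}(E_{ij}) τ^{hol}(E_{ji})`,
  `Σ_{ij} τ^{anti}(E_{ij}) τ^{anti}(E_{ji})` of the factor `𝔤𝔩_n(ℂ)` are scalars on `𝒢`.

Each is Segal's lemma (`ArchGardingSegal.exists_eq_smul_of_invariant_of_partner`) applied to an
`Ad(G)`-invariant operator (`ArchPlaceCasimirReal`, `ArchPlaceCasimirComplex`) whose formal adjoint on
`𝒢` is a Casimir operator again. This is the statement "`Z` operates by scalars on `ℋ^∞`" for the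
centre `𝔷 ∋ C_w` of the enveloping algebra used in Jacquet–Shalika's automatic-continuity argument
(Jacquet–Shalika (1981), proof of Prop. (3.8), p. 523), on the route to the named fact
`Literature.NumberTheory.Automorphic.JacquetShalika1981_archKirillovNorm_le`.

## References

* H. Jacquet, J. A. Shalika, *On Euler products and the classification of automorphic
  representations I*, Amer. J. Math. 103 (1981), §3, Prop. (3.8), p. 523 [JacquetShalikaAJM1981].
* A. W. Knapp, *Representation Theory of Semisimple Groups*, Princeton (1986), Ch. VIII §3
  (Casimir operator; infinitesimal character) [Knapp1986].
* A. W. Knapp, D. A. Vogan, *Cohomological Induction and Unitary Representations*, Princeton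
  (1995), Introduction, Thm. 0.2 [KnappVogan1995].
-/

noncomputable section

open MeasureTheory Measure NumberField NumberField.mixedEmbedding NumberField.InfinitePlace IsDedekindDomain Set Filter
open scoped MatrixGroups ENNReal NNReal Classical Topology InnerProductSpace ComplexConjugate

namespace Literature.NumberTheory.Automorphic

variable {n : ℕ} {K : Type} [Field K] [NumberField K]

attribute [local instance] glInfBorel borelSpace_glInf locallyCompactSpace_glInf secondCountableTopology_glInf

-- as in `ArchGardingWhittaker`
set_option backward.isDefEq.respectTransparency false

variable {hcpt : isCompact_glFiniteIntegralLevel n K}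
  {E : Type*} [NormedAddCommGroup E] [InnerProductSpace ℂ E] [CompleteSpace E]
  {τ : ContRepresentation ℂ (AutomorphyDatum.gl n K hcpt).arch.carrier E}

/-- Additivity of `u ↦ τ(X) τ(Y) u` on Gårding vectors (the two-letter word `[X, Y]`). [folklore] -/
theorem archDerivE_archDerivE_add (hτ : τ.IsStronglyContinuous) (X Y : Matrix (Fin n) (Fin n) (mixedSpace K))
    {u u' : E} (hu : u ∈ archGardingSpace hcpt τ) (hu' : u' ∈ archGardingSpace hcpt τ) :
    archDerivE hcpt τ X (archDerivE hcpt τ Y (u + u')) =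
      archDerivE hcpt τ X (archDerivE hcpt τ Y u) + archDerivE hcpt τ X (archDerivE hcpt τ Y u') := by
  have h := archWordDerivE_add hτ hu hu' [X, Y]
  simpa only [archWordDerivE_cons, archWordDerivE_nil] using h

/-- Homogeneity of `u ↦ τ(X) τ(Y) u` on Gårding vectors. [folklore] -/
theorem archDerivE_archDerivE_smul (hτ : τ.IsStronglyContinuous) (X Y : Matrix (Fin n) (Fin n) (mixedSpace K))
    (a : ℂ) {u : E} (hu : u ∈ archGardingSpace hcpt τ) :
    archDerivE hcpt τ X (archDerivE hcpt τ Y (a • u)) = a • archDerivE hcpt τ X (archDerivE hcpt τ Y u) := by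
  have h := archWordDerivE_smul hτ a hu [X, Y]
  simpa only [archWordDerivE_cons, archWordDerivE_nil] using h

/-- **The Casimir operator of a real place is a scalar on the Gårding space** of an irreducible unitary
representation of `GL_n(K_∞)`: `Σ_{ij} τ(E_{ij} ⊗ r_w) τ(E_{ji} ⊗ r_w) v = c_w • v` (Segal's lemma for the
`Ad(G)`-invariant, formally symmetric operator `C_w`). Jacquet–Shalika (1981), p. 523 ("`Z` operates by
scalars"); Knapp (1986), Ch. VIII §3 (Cor. 8.14: the Casimir operator acts by a scalar in an irreducible
unitary representation). [cite: JacquetShalikaAJM1981, §3, Prop. (3.8), p. 523] [cite: Knapp1986, Ch. VIII §3] -/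
theorem exists_placeCasimirReal_eq_smul (hτ : τ.IsStronglyContinuous) (hτu : τ.IsUnitary) (hτi : τ.IsTopIrreducible)
    (w : {w : InfinitePlace K // IsReal w}) :
    ∃ c : ℂ, ∀ v ∈ archGardingSpace hcpt τ,
      ∑ i, ∑ j, archDerivE hcpt τ (Matrix.single i j ((Pi.single w 1, 0) : mixedSpace K))
        (archDerivE hcpt τ (Matrix.single j i ((Pi.single w 1, 0) : mixedSpace K)) v) = c • v := by
  set r : mixedSpace K := (Pi.single w 1, 0) with hr
  refine exists_eq_smul_of_invariant_of_partner hτ hτu hτi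
    (fun v => ∑ i, ∑ j, archDerivE hcpt τ (Matrix.single i j r) (archDerivE hcpt τ (Matrix.single j i r) v))
    (fun v => ∑ i, ∑ j, archDerivE hcpt τ (Matrix.single i j r) (archDerivE hcpt τ (Matrix.single j i r) v))
    (fun v hv v' hv' => ?_) (fun c v hv => ?_) (fun g v hv => ?_) (fun v hv u hu => ?_)
  · simp only [archDerivE_archDerivE_add hτ _ _ hv hv', Finset.sum_add_distrib]
  · simp only [archDerivE_archDerivE_smul hτ _ _ c hv, Finset.smul_sum]
  · exact apply_toArch_placeCasimirReal hτ w g hv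
  · exact inner_sum_sum_archDerivE_archDerivE_left hτ hτu (fun i j => Matrix.single i j r) hv hu

/-- **The holomorphic Casimir operator of a complex place is a scalar on the Gårding space** of an
irreducible unitary representation of `GL_n(K_∞)`: `Σ_{ij} τ^{hol}(E_{ij}) τ^{hol}(E_{ji}) v = c • v`
(Segal's lemma; the formal adjoint is the antiholomorphic Casimir). Knapp (1986), Ch. VIII §3.
[cite: JacquetShalikaAJM1981, §3, Prop. (3.8), p. 523] [cite: Knapp1986, Ch. VIII §3] -/
theorem exists_placeCasimirHol_eq_smul (hτ : τ.IsStronglyContinuous) (hτu : τ.IsUnitary) (hτi : τ.IsTopIrreducible)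
    (w : {w : InfinitePlace K // IsComplex w}) :
    ∃ c : ℂ, ∀ v ∈ archGardingSpace hcpt τ,
      ∑ i, ∑ j, archDerivHol hcpt τ w i j (archDerivHol hcpt τ w j i v) = c • v := by
  refine exists_eq_smul_of_invariant_of_partner hτ hτu hτi
    (fun v => ∑ i, ∑ j, archDerivHol hcpt τ w i j (archDerivHol hcpt τ w j i v))
    (fun v => ∑ i, ∑ j, archDerivAnti hcpt τ w i j (archDerivAnti hcpt τ w j i v))
    (fun v hv v' hv' => ?_) (fun c v hv => ?_) (fun g v hv => ?_) (fun v hv u hu => ?_)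
  · rw [← Finset.sum_add_distrib]
    refine Finset.sum_congr rfl fun i _ => ?_
    rw [← Finset.sum_add_distrib]
    refine Finset.sum_congr rfl fun j _ => ?_
    rw [archDerivHol_add hτ w j i hv hv',
      archDerivHol_add hτ w i j (archDerivHol_mem hτ w j i hv) (archDerivHol_mem hτ w j i hv')]
  · rw [Finset.smul_sum]
    refine Finset.sum_congr rfl fun i _ => ?_
    rw [Finset.smul_sum]
    refine Finset.sum_congr rfl fun j _ => ?_
    rw [archDerivHol_smul hτ w j i c hv, archDerivHol_smul hτ w i j c (archDerivHol_mem hτ w j i hv)]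
  · exact apply_toArch_placeCasimirHol hτ w g hv
  · exact inner_placeCasimirHol_left hτ hτu w hv hu

/-- **The antiholomorphic Casimir operator of a complex place is a scalar on the Gårding space** of an
irreducible unitary representation of `GL_n(K_∞)`: `Σ_{ij} τ^{anti}(E_{ij}) τ^{anti}(E_{ji}) v = c • v`.
[cite: JacquetShalikaAJM1981, §3, Prop. (3.8), p. 523] [cite: Knapp1986, Ch. VIII §3] -/
theorem exists_placeCasimirAnti_eq_smul (hτ : τ.IsStronglyContinuous) (hτu : τ.IsUnitary) (hτi : τ.IsTopIrreducible)
    (w : {w : InfinitePlace K // IsComplex w}) :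
    ∃ c : ℂ, ∀ v ∈ archGardingSpace hcpt τ,
      ∑ i, ∑ j, archDerivAnti hcpt τ w i j (archDerivAnti hcpt τ w j i v) = c • v := by
  refine exists_eq_smul_of_invariant_of_partner hτ hτu hτi
    (fun v => ∑ i, ∑ j, archDerivAnti hcpt τ w i j (archDerivAnti hcpt τ w j i v))
    (fun v => ∑ i, ∑ j, archDerivHol hcpt τ w i j (archDerivHol hcpt τ w j i v))
    (fun v hv v' hv' => ?_) (fun c v hv => ?_) (fun g v hv => ?_) (fun v hv u hu => ?_)
  · rw [← Finset.sum_add_distrib]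
    refine Finset.sum_congr rfl fun i _ => ?_
    rw [← Finset.sum_add_distrib]
    refine Finset.sum_congr rfl fun j _ => ?_
    rw [archDerivAnti_add hτ w j i hv hv',
      archDerivAnti_add hτ w i j (archDerivAnti_mem hτ w j i hv) (archDerivAnti_mem hτ w j i hv')]
  · rw [Finset.smul_sum]
    refine Finset.sum_congr rfl fun i _ => ?_
    rw [Finset.smul_sum]
    refine Finset.sum_congr rfl fun j _ => ?_
    rw [archDerivAnti_smul hτ w j i c hv, archDerivAnti_smul hτ w i j c (archDerivAnti_mem hτ w j i hv)]
  · exact apply_toArch_placeCasimirAnti hτ w g hv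
  · exact inner_placeCasimirAnti_left hτ hτu w hv hu

end Literature.NumberTheory.Automorphic
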